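import Summits.BirchSwinnertonDyer.BirchSwinnertonDyer.Theorems.Rank1ResidualJetThm63KernelInputsCM
import Summits.BirchSwinnertonDyer.Rank1Residual.JET.KolyvaginClassSignUnconditional
import HarnessLib

/-!
# T1 JET (cell `bsd-jet`), road K: the H63 line «v3» — kernel bricks plugged in, Gross Prop. 5.3
# STRUCK (sign unconditional), Gross §3 CM facts PROVED, [GZ86 III (3.1)] scoped to Kolyvagin conductors

HONEST FRAMING (programme file §HONESTY, verbatim): «no tranche here proves BSD; ARM L moves the
LITERAL column of an r ≤ 1 census into the kernel-proved-modulo-named-print column.» THEOREMS ONLY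
(seat `bsd-jet-pv-2`, session g5; `--supports stmt-BirchSwinnertonDyer-14418`, helper); 0 classes
move. WHAT THIS IS. The H63 line `JET.tamagawaExponent_le_mInfty_of_kernelInputs` (p501299) and its
CM twin `…_of_kernelInputs'` carry three cite-only schemas: `h53` (Gross 1991 Prop. 5.3 with the Fricke
sign `ε`, universal in the conductor `m`), `hGZ` ([GZ86 III (3.1)] in x11b3's receptacle form, universal
in `m`) and the two §3 CM facts. Reader 1 (ADD-9 annex 4/5) and the typer found: `h53` is SUPERSEDED —
`JET.sign_conjAct_kolyvaginClass` (p527071, `KolyvaginClassSignUnconditional`) gives Gross Prop. 5.4 for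
OUR class with `ε = −w(E)` and NO Prop. 5.3 hypothesis; and the universal-in-`m` closure of `hGZ` is
satisfiability-unverified (the print, Gross 1991 §3 (3.1), speaks of square-free conductors prime to `N`
whose prime factors are Kolyvagin primes). This file re-runs the H63 line APPEND-ONLY as new
declarations with exactly those edits (the tree's statements are untouched):
* `localization_kolyvaginClass_mem_kummerSelmerStructure_of_GZ31_kolyvagin` — the Kummer part of
  `hκsel` (p498536) with `hGZ` asked only at square-free `m` whose prime factors are Zhang–Kolyvagin
  primes (its proof uses `hGZ` at the divisors of `c` only) and the CM facts fed by
  `phi_heegnerPointOfConductor_mem_range_map_ringClassField_holds` / `exists_generator_ringClassGalOver_holds`;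
* `tamagawaExponent_le_mInfty_of_kernelInputs_v3` — p501299 VERBATIM except: binders `hCM1`, `hCM2`,
  `ε`, `hε`, `h53` deleted; `he' : e' = −W.rootNumber · (−1)^{#primes of c}`; the two sign calls are
  `sign_conjAct_kolyvaginClass`; `hGZ` in the Kolyvagin-scoped shape above.
Remaining hypotheses of the line: named print {`h44`, `hGZ` (scoped)} and the kernel gaps {`htr`, `hT`,
`h49str`, `h49tr`, `hdual_q`, `hdual_ℓ`} with the structure parameters — nothing else.
References: [cite: Jetchev2008, Thm. 5.2 (p. 821) and proof; Prop. 4.6, Prop. 4.9 (p. 820)]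
[cite: McCallumLMS1991, §4 Prop. 4.4, §5 (p. 305)] [cite: GrossLMS1991, §3 (3.1), Prop. 5.3, Prop. 5.4,
Prop. 6.2 (1)] [cite: GrossZagier1986, III (3.1)].
-/

set_option autoImplicit false

noncomputable section

open scoped Classical

open WeierstrassCurve IsDedekindDomain NumberField Literature.NumberTheory.EllipticCurves
  Literature.NumberTheory.EllipticCurves.ModularForms Literature.NumberTheory.EllipticCurves.Jetchev2008
  Literature.NumberTheory.GaloisRepresentations
  Literature.NumberTheory.GaloisRepresentations.DiscreteGaloisModule
  Literature.NumberTheory.EllipticCurves.KolyvaginCocycle Literature.NumberTheory.EllipticCurves.KolyvaginEuler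
  Literature.NumberTheory.EllipticCurves.RingClassField
  Summit.BirchSwinnertonDyer.Rank1Residual.X11b Summit.BirchSwinnertonDyer.Rank1Residual.X11b.Three
  Summit.BirchSwinnertonDyer.Rank1Residual.X11b.Three.GrossBadPlace
  Summit.BirchSwinnertonDyer.Rank1Residual.X11b.KolyvaginHloc

namespace Summit.BirchSwinnertonDyer.Rank1Residual.JET

section Kummer

variable {K : Type} [Field K] [NumberField K] {W : WeierstrassCurve ℚ}

/-- **The Kummer part of `hκsel` modulo [GZ86 III (3.1)] AT KOLYVAGIN CONDUCTORS** —
`localization_kolyvaginClass_mem_kummerSelmerStructure_of_GZ31` (p498536) with the receptacle schema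
`hGZ` asked only at square-free `m` all of whose prime factors are Zhang–Kolyvagin primes (the printed
scope of Gross 1991 §3 (3.1); the proof calls it at the divisors of `c`, which are such) and the two
Gross §3 CM facts PROVED (`…_holds`). At every place `v` of `K` not over a prime factor of `c`:
`loc_v c_k(c) ∈ H¹_Kum(K_v, E[p^k])`. [cite: GrossLMS1991, §3 (3.1), §6 Prop. 6.2 (1)]
[cite: GrossZagier1986, III (3.1)] [cite: Jetchev2008, §3.3.1/§3.4.1 (p. 816), Prop. 4.6 (p. 820)] -/
theorem localization_kolyvaginClass_mem_kummerSelmerStructure_of_GZ31_kolyvagin [W.IsElliptic]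
    [W.IsGloballyMinimal] [NeZero (W.conductorNorm ℤ)]
    (hK : IsImaginaryQuadratic K) (hD3 : NumberField.discr K ≠ -3) (hD4 : NumberField.discr K ≠ -4)
    (hH : SatisfiesHeegnerHypothesis (W.conductorNorm ℤ) K)
    {p : ℕ} [Fact p.Prime] (hp2 : p ≠ 2) (hρ : W.HasSurjectiveModNGaloisRep p)
    (Dt : ModularParametrizationData W (W.conductorNorm ℤ)) (β : ℤ) (ι : K →+* ℂ)
    {n' : ℤ} (hcop' : IsCoprime (p : ℤ) n')
    (hGZ : ∀ (m : ℕ), Squarefree m →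
      (∀ q ∈ m.primeFactors, Zhang2014.IsKolyvaginPrime (W.conductorNorm ℤ) W K p q) →
      ∀ (dm : KolyvaginHeegnerData Dt β ι m)
      (γ : ringClassField K ι m ≃ₐ[ℚ] ringClassField K ι m), γ ∈ ringClassGal ι m →
      ∀ v : HeightOneSpectrum (𝓞 K), ¬ (W.baseChange K).HasGoodReductionAt v →
        n' • pointsMap (W.baseChange K) (v.adicCompletion K)
            (dm.toGeomPoints (pointGalHom W (ringClassField K ι m) γ dm.y)) ∈
          E0Receptacle (W.baseChange K) v ∧
        ∀ (ℓ : ℕ), ℓ ∈ m.primeFactors → ∀ (dm' : KolyvaginHeegnerData Dt β ι (m / ℓ))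
          (hle : ringClassField K ι (m / ℓ) ≤ ringClassField K ι m),
          n' • pointsMap (W.baseChange K) (v.adicCompletion K)
              (dm.toGeomPoints (pointGalHom W (ringClassField K ι m) γ
                (WeierstrassCurve.Affine.Point.map (W' := W)
                  ((RingClassField.inclusion ι hle).restrictScalars ℚ) dm'.y))) ∈
            E0Receptacle (W.baseChange K) v)
    {c : ℕ} (hc : Squarefree c) {k : ℕ}
    (hcK : ∀ ℓ ∈ c.primeFactors, Zhang2014.IsKolyvaginPrime (W.conductorNorm ℤ) W K p ℓ ∧
      k ≤ Zhang2014.kolyvaginIndex W p ℓ)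
    (d : KolyvaginHeegnerData Dt β ι c) [∀ j : ℕ, NumberField (ringClassField K ι j)]
    (v : Place K) (hv : ∀ ℓ ∈ c.primeFactors, ¬ Jetchev2008.PlaceOver K v ℓ) :
    galoisCohomology.localization ((W.baseChange K).torsionGaloisModule ((p ^ k : ℕ) : ℤ)) v 1
        (d.kolyvaginClass (Fact.out : p.Prime) k) ∈
      (W.baseChange K).kummerSelmerStructure ((p ^ k : ℕ) : ℤ) v := by
  have hp : p.Prime := Fact.out
  rcases v with w | 𝔳
  · -- complex place: `H¹(ℂ, ·) = 0`
    haveI : IsTotallyComplex K := hK.2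
    have hw : w.IsComplex := IsTotallyComplex.isComplex w
    have htop := GlobalDuality.addSubgroup_galoisCohomology_inl_eq_top_of_isComplex
      ((W.baseChange K).torsionGaloisModule ((p ^ k : ℕ) : ℤ)) hw
      ((W.baseChange K).kummerSelmerStructure ((p ^ k : ℕ) : ℤ) (Sum.inl w))
    rw [htop]
    exact AddSubgroup.mem_top _
  · -- finite place `𝔳 ∤ c`
    have hcv : (c : 𝓞 K) ∉ 𝔳.asIdeal := fun h ↦ by
      obtain ⟨ℓ, hℓ, hℓv⟩ := exists_primeFactor_mem_of_natCast_mem hc 𝔳 h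
      exact hv ℓ hℓ ⟨𝔳, rfl, hℓv⟩
    have hND : IsCoprime (W.conductorNorm ℤ : ℤ) (NumberField.discr K) :=
      KolyvaginAssembly.isCoprime_discr_of_satisfiesHeegnerHypothesis hK hH
    have hD : NumberField.discr K < -4 := KolyvaginAssembly.discr_lt_neg_four hK ⟨hD3, hD4⟩
    have hinert : ∀ (m' : ℕ), m' ∣ c → ∀ q ∈ m'.primeFactors, (Ideal.span {(q : 𝓞 K)}).IsPrime :=
      fun m' hm' q hq ↦ (hcK q (Nat.primeFactors_mono hm' hc.ne_zero hq)).1.2.2.2.2.1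
    -- data at every divisor of `c` (the given `d` at `c` itself)
    have hne : ∀ m' : ℕ, m' ∣ c → Nonempty (KolyvaginHeegnerData Dt β ι m') := fun m' hm' ↦
      BirchSwinnertonDyer.Theorems.nonempty_kolyvaginHeegnerData_of_grossCM
        (phi_heegnerPointOfConductor_mem_range_map_ringClassField_holds (W.conductorNorm ℤ) W K)
        exists_generator_ringClassGalOver_holds hK hH Dt β ι
        d.dvd_sq_sub (hc.squarefree_of_dvd hm') (hinert m' hm')
    let data : (m' : ℕ) → m' ∣ c → KolyvaginHeegnerData Dt β ι m' := fun m' hm' ↦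
      if h : m' = c then h ▸ d else (hne m' hm').some
    have hdata : data c dvd_rfl = d := by simp [data]
    have hcop : IsCoprime ((p ^ k : ℕ) : ℤ) n' := by
      rw [Nat.cast_pow]; exact IsCoprime.pow_left hcop'
    -- the guard at a divisor `m ∣ c`: square-free with Zhang–Kolyvagin prime factors
    have hg : ∀ m : ℕ, m ∣ c → Squarefree m ∧
        ∀ q ∈ m.primeFactors, Zhang2014.IsKolyvaginPrime (W.conductorNorm ℤ) W K p q :=
      fun m hm ↦ ⟨hc.squarefree_of_dvd hm,
        fun q hq ↦ (hcK q (Nat.primeFactors_mono hm hc.ne_zero hq)).1⟩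
    have h := hloc_concrete_of_GZ31_zhang hK ι hp Dt hND hD hc hcK data hcop
      (fun m hm γ hγ v hbad ↦ ⟨(hGZ m (hg m hm).1 (hg m hm).2 (data m hm) γ hγ v hbad).1,
        fun ℓ hℓ hle ↦ (hGZ m (hg m hm).1 (hg m hm).2 (data m hm) γ hγ v hbad).2 ℓ hℓ _ hle⟩)
      (fun m hm ↦ RingClassNoTorsion.isAdmissible_pointsSubgroup _ hK
        (ne_zero_of_dvd_ne_zero hc.ne_zero hm) hp hp2 hρ k) c dvd_rfl 𝔳 hcv
    rw [hdata] at h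
    rw [← AddSubgroup.mem_comap, (W.baseChange K).comap_localization_kummerSelmerStructure]
    exact h


end Kummer

/-- **[J] Thm 5.2 at a core vertex, H63 line «v3»** — `tamagawaExponent_le_mInfty_of_kernelInputs`
(p501299) with Gross Prop. 5.3 STRUCK (`e' = −w(E)(−1)^r`, `JET.sign_conjAct_kolyvaginClass`), the CM
facts PROVED, and [GZ86 III (3.1)] scoped to square-free Kolyvagin conductors. Remaining named print:
`h44`, `hGZ` (scoped); remaining kernel gaps: `htr`, `hT`, `h49str`, `h49tr`, `hdual_q`, `hdual_ℓ`.
CONCLUSION: `t ≤ m_∞`. [cite: Jetchev2008, Thm. 5.2 (p. 821) and proof]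
[cite: McCallumLMS1991, §4 Prop. 4.4, §5 (p. 305)] [cite: GrossLMS1991, Prop. 5.4, Prop. 6.2 (1)]
[cite: GrossZagier1986, III (3.1)] -/
theorem tamagawaExponent_le_mInfty_of_kernelInputs_v3
    (h44 : McCallum1991.prop44_localOrder_kolyvaginClass_mul_eq)
    (W : WeierstrassCurve ℚ) [W.IsElliptic] [W.IsGloballyMinimal] [NeZero (W.conductorNorm ℤ)]
    (hcm : ¬ W.HasCM) (K : Type) [Field K] [NumberField K] (hK : IsImaginaryQuadratic K)
    (hD3 : NumberField.discr K ≠ -3) (hD4 : NumberField.discr K ≠ -4)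
    (hH : SatisfiesHeegnerHypothesis (W.conductorNorm ℤ) K)
    (p : ℕ) [Fact p.Prime] (hp2 : p ≠ 2) (htower : ∀ n : ℕ, W.HasSurjectiveModNGaloisRep (p ^ n : ℕ))
    (Dt : ModularParametrizationData W (W.conductorNorm ℤ)) (β : ℤ) (ι : K →+* ℂ)
    [∀ j : ℕ, NumberField (ringClassField K ι j)]
    (τ : K ≃ₐ[ℚ] K) (hτ : τ ≠ 1)
    -- [GZ86 III (3.1)] in the receptacle form at SQUARE-FREE KOLYVAGIN conductors, with `n'` prime to
    -- `p` (cite-only named input, the printed scope)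
    {n' : ℤ} (hcop' : IsCoprime (p : ℤ) n')
    (hGZ : ∀ (m : ℕ), Squarefree m →
      (∀ q ∈ m.primeFactors, Zhang2014.IsKolyvaginPrime (W.conductorNorm ℤ) W K p q) →
      ∀ (dm : KolyvaginHeegnerData Dt β ι m)
      (γ : ringClassField K ι m ≃ₐ[ℚ] ringClassField K ι m), γ ∈ ringClassGal ι m →
      ∀ v : HeightOneSpectrum (𝓞 K), ¬ (W.baseChange K).HasGoodReductionAt v →
        n' • pointsMap (W.baseChange K) (v.adicCompletion K)
            (dm.toGeomPoints (pointGalHom W (ringClassField K ι m) γ dm.y)) ∈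
          E0Receptacle (W.baseChange K) v ∧
        ∀ (ℓ : ℕ), ℓ ∈ m.primeFactors → ∀ (dm' : KolyvaginHeegnerData Dt β ι (m / ℓ))
          (hle : ringClassField K ι (m / ℓ) ≤ ringClassField K ι m),
          n' • pointsMap (W.baseChange K) (v.adicCompletion K)
              (dm.toGeomPoints (pointGalHom W (ringClassField K ι m) γ
                (WeierstrassCurve.Affine.Point.map (W' := W)
                  ((RingClassField.inclusion ι hle).restrictScalars ℚ) dm'.y))) ∈
            E0Receptacle (W.baseChange K) v)
    -- the `H63` binder's bookkeeping: `mdiv`, `m`, the level `k`, the core vertex `c`, `m(c) = m_∞`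
    (mdiv m : {c : ℕ // Squarefree c ∧ ∀ ℓ ∈ c.primeFactors,
        Zhang2014.IsKolyvaginPrime (W.conductorNorm ℤ) W K p ℓ} → ℕ∞)
    (hmdiv : ∀ c (u : ℕ), (u : ℕ∞) ≤ mdiv c ↔ ∀ d : KolyvaginHeegnerData Dt β ι c.1,
      ∃ Q : (W.baseChange (ringClassField K ι c.1)).toAffine.Point,
        ((p ^ u : ℕ) : ℤ) • Q = d.derivedPoint)
    (hm : ∀ c, m c = if mdiv c < Zhang2014.levelIndex W p c.1 then mdiv c else ⊤)
    (k : ℕ) (c : {c : ℕ // Squarefree c ∧ ∀ ℓ ∈ c.primeFactors,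
        Zhang2014.IsKolyvaginPrime (W.conductorNorm ℤ) W K p ℓ}) (hk : 1 ≤ k)
    (hcore : IsGlobalCoreVertex W K ι τ p k c.1) (mInf : ℕ) (hmc : m c = mInf)
    (hkM : (k : ℕ∞) + mInf ≤ Zhang2014.levelIndex W p c.1)
    (t : ℕ) (htk : t < k) (hik : mInf < k)
    -- the structures (parameters): local transverse family, stringent family, carrier places, dual module
    (𝒯 𝒮 : SelmerStructure ((W.baseChange K).torsionGaloisModule ((p ^ k : ℕ) : ℤ)))
    (hT : ∀ x : galoisCohomology ((W.baseChange K).torsionGaloisModule ((p ^ k : ℕ) : ℤ)) 1,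
      (∀ w ∈ placesDividing K c.1,
        galoisCohomology.localization ((W.baseChange K).torsionGaloisModule ((p ^ k : ℕ) : ℤ))
          (Sum.inr w) 1 x ∈ 𝒯 (Sum.inr w)) ↔
      ∀ ℓ ∈ c.1.primeFactors, x ∈ transverseKer W K ι ((p ^ k : ℕ) : ℤ) ℓ)
    (hS : ∀ v, 𝒮 v ≤ (W.baseChange K).kummerSelmerStructure ((p ^ k : ℕ) : ℤ) v)
    (Qcar : Finset (HeightOneSpectrum (𝓞 K))) (hQcar : Disjoint Qcar (placesDividing K c.1))
    (e' : ℤ) (he' : e' = -W.rootNumber * (-1) ^ c.1.primeFactors.card)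
    (C' : AddSubgroup (galH1Torsion (W.baseChange K) ((p ^ k : ℕ) : ℤ)))
    (hC : C' ≤ signPart W K τ ((p ^ k : ℕ) : ℤ) (-e') ⊤)
    -- KERNEL GAP (S2/S10): the transverse condition of `c_k(c)` at the primes of `c`
    (htr : ∀ (d : KolyvaginHeegnerData Dt β ι c.1), ∀ ℓ ∈ c.1.primeFactors,
      (d.kolyvaginClass (Fact.out : p.Prime) k :
        galoisCohomology ((W.baseChange K).torsionGaloisModule ((p ^ k : ℕ) : ℤ)) 1) ∈
        transverseKer W K ι ((p ^ k : ℕ) : ℤ) ℓ)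
    -- KERNEL GAP (S1/S3): Thm 5.1 at the carrier + (δ)
    (hdual_q : ∃ (Qg Qg' : Type) (_ : AddCommGroup Qg) (_ : AddCommGroup Qg') (_ : Finite Qg')
      (locq : signPart W K τ ((p ^ k : ℕ) : ℤ) (-e')
        (modifiedSelmerGroup W K ι ((p ^ k : ℕ) : ℤ) c.1) →+ Qg)
      (locq' : C' →+ Qg'),
      (∀ x : C', locq' x = 0 ↔ (x : galH1Torsion (W.baseChange K) ((p ^ k : ℕ) : ℤ)) ∈
        signPart W K τ ((p ^ k : ℕ) : ℤ) (-e') (modifiedSelmerGroup W K ι ((p ^ k : ℕ) : ℤ) c.1)) ∧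
      Nat.card locq.range * Nat.card locq'.range = Nat.card Qg' ∧ IsAddCyclic Qg' ∧ Nat.card Qg' = p ^ t)
    -- KERNEL GAPS (S6/S10): Prop 4.9♯ for the classes at `cℓ` — STRINGENT part at the carrier places
    -- (Jetchev's Prop. 4.9 proper: the x11b3 layer theorem at `v ∣ p` / Lemma 4.3 at `q ≠ p`) and
    -- TRANSVERSE part at the primes of `c`; the sign and Kummer parts are discharged below
    (h49str : ∀ (ℓ : ℕ), Zhang2014.IsKolyvaginPrime (W.conductorNorm ℤ) W K p ℓ →
      k ≤ Zhang2014.kolyvaginIndex W p ℓ → ℓ ∉ c.1.primeFactors →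
      ∀ (d' : KolyvaginHeegnerData Dt β ι (c.1 * ℓ)), ∀ q ∈ Qcar,
      galoisCohomology.localization ((W.baseChange K).torsionGaloisModule ((p ^ k : ℕ) : ℤ))
          (Sum.inr q) 1 (d'.kolyvaginClass (Fact.out : p.Prime) k) ∈ 𝒮 (Sum.inr q))
    (h49tr : ∀ (ℓ : ℕ), Zhang2014.IsKolyvaginPrime (W.conductorNorm ℤ) W K p ℓ →
      k ≤ Zhang2014.kolyvaginIndex W p ℓ → ℓ ∉ c.1.primeFactors →
      ∀ (d' : KolyvaginHeegnerData Dt β ι (c.1 * ℓ)), ∀ w ∈ placesDividing K c.1,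
      galoisCohomology.localization ((W.baseChange K).torsionGaloisModule ((p ^ k : ℕ) : ℤ))
          (Sum.inr w) 1 (d'.kolyvaginClass (Fact.out : p.Prime) k) ∈ 𝒯 (Sum.inr w))
    -- KERNEL GAP (S1): Thm 5.1 / Lemma 5.2 (iii) at `λ`
    (hdual_ℓ : ∀ (ℓ : ℕ), Zhang2014.IsKolyvaginPrime (W.conductorNorm ℤ) W K p ℓ →
      k ≤ Zhang2014.kolyvaginIndex W p ℓ → ℓ ∉ c.1.primeFactors →
      ∀ (v : HeightOneSpectrum (𝓞 K)), (ℓ : 𝓞 K) ∈ v.asIdeal →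
      ∃ (Sg : Type) (_ : AddCommGroup Sg)
        (sing : signPart W K τ ((p ^ k : ℕ) : ℤ) (-e')
          (((selmerF0 W ((p ^ k : ℕ) : ℤ) 𝒯 𝒮 (placesDividing K c.1) Qcar).relaxedAt {v}).selmerGroup) →+ Sg),
        (∀ x, sing x = 0 ↔ (x : galoisCohomology ((W.baseChange K).torsionGaloisModule ((p ^ k : ℕ) : ℤ)) 1) ∈
          signPart W K τ ((p ^ k : ℕ) : ℤ) (-e')
            ((selmerF0 W ((p ^ k : ℕ) : ℤ) 𝒯 𝒮 (placesDividing K c.1) Qcar).selmerGroup)) ∧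
        Nat.card sing.range *
          Nat.card (C'.map (galoisCohomology.localization
            ((W.baseChange K).torsionGaloisModule ((p ^ k : ℕ) : ℤ)) (Sum.inr v) 1 :
              galH1Torsion (W.baseChange K) ((p ^ k : ℕ) : ℤ) →+ _)) = p ^ k) :
    t ≤ mInf := by
  have hp : p.Prime := Fact.out
  have hρ : W.HasSurjectiveModNGaloisRep p := by simpa using htower 1
  have hD : NumberField.discr K < -4 := KolyvaginAssembly.discr_lt_neg_four hK ⟨hD3, hD4⟩
  -- level bookkeeping: `k ≤ M(c)`, hence `k ≤ M(ℓ)` at the primes of `c`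
  have hkc : (k : ℕ∞) ≤ Zhang2014.levelIndex W p c.1 := le_trans le_self_add hkM
  have hcK : ∀ ℓ ∈ c.1.primeFactors, Zhang2014.IsKolyvaginPrime (W.conductorNorm ℤ) W K p ℓ ∧
      k ≤ Zhang2014.kolyvaginIndex W p ℓ := fun ℓ hℓ ↦
    ⟨c.2.2 ℓ hℓ, Zhang2014.natCast_le_levelIndex_iff.mp hkc ℓ hℓ⟩
  -- (S7) the datum `d` of conductor `c` with `p^{m_∞} ∥ P_c`, `ord c_k(c) = p^{k − m_∞}`, `c_k(c) ≠ 0`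
  have hCM1 := phi_heegnerPointOfConductor_mem_range_map_ringClassField_holds (W.conductorNorm ℤ) W K
  have hCM2 : exists_generator_ringClassGalOver K := exists_generator_ringClassGalOver_holds
  obtain ⟨d, -, -, hordκ, hκ0⟩ := exists_datum_addOrderOf_kolyvaginClass_of_m_eq hCM1 hCM2 hK hD3 hD4
    hH hp2 hρ Dt β ι mdiv m hmdiv hm c mInf k hmc hik hkc
  -- (sign) Gross Prop 5.4 UNCONDITIONAL (read-1 p527071): `τ c_k(c) = e' c_k(c)`, `e' = −w(E)(−1)^r`
  obtain ⟨he, hκsign⟩ := sign_conjAct_kolyvaginClass hK hD3 hD4 hH hp2 hρ τ hτ Dt β ι c.2.1 hk hcK d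
  rw [← he'] at he hκsign
  -- (Selmer membership) Kummer part by Gross 6.2 (1) mod GZ31, transverse part = the gap `htr`
  have hκsel : d.kolyvaginClass hp k ∈ modifiedSelmerGroup W K ι ((p ^ k : ℕ) : ℤ) c.1 :=
    (mem_modifiedSelmerGroup_iff W K ι ((p ^ k : ℕ) : ℤ) c.1 _).mpr
      ⟨fun v hv ↦ localization_kolyvaginClass_mem_kummerSelmerStructure_of_GZ31_kolyvagin hK hD3
        hD4 hH hp2 hρ Dt β ι hcop' hGZ c.2.1 hcK d v hv, htr d⟩
  -- (compatible data at `cℓ`) from the CM fact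
  obtain ⟨dℓ, hdℓ⟩ := exists_compatible_data_of_grossCM hCM1 hK hD hH p Dt β ι c.2.1
    (fun ℓ hℓ ↦ c.2.2 ℓ hℓ) d
  -- (Prop 4.9♯ at `cℓ`) sign and Kummer parts discharged; stringent + transverse = the gaps
  have hc0 : c.1 ≠ 0 := c.2.1.ne_zero
  have h49 : ∀ (ℓ : ℕ) (h1 : Zhang2014.IsKolyvaginPrime (W.conductorNorm ℤ) W K p ℓ)
      (h2 : k ≤ Zhang2014.kolyvaginIndex W p ℓ) (h3 : ℓ ∉ c.1.primeFactors)
      (v : HeightOneSpectrum (𝓞 K)), (ℓ : 𝓞 K) ∈ v.asIdeal →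
      (dℓ ℓ h1 h3).kolyvaginClass hp k ∈
        signPart W K τ ((p ^ k : ℕ) : ℤ) (-e')
          (((selmerF0 W ((p ^ k : ℕ) : ℤ) 𝒯 𝒮 (placesDividing K c.1) Qcar).relaxedAt {v}).selmerGroup) := by
    intro ℓ h1 h2 h3 v hv
    have hl : ℓ.Prime := h1.1
    have hlc : ¬ ℓ ∣ c.1 := fun h ↦ h3 (Nat.mem_primeFactors.mpr ⟨hl, h, hc0⟩)
    have hcl : Squarefree (c.1 * ℓ) :=
      (Nat.squarefree_mul ((Nat.Prime.coprime_iff_not_dvd hl).mpr hlc).symm).mpr ⟨c.2.1, hl.squarefree⟩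
    have hpf : (c.1 * ℓ).primeFactors = c.1.primeFactors ∪ {ℓ} := by
      rw [Nat.primeFactors_mul hc0 hl.ne_zero, hl.primeFactors]
    have hcKℓ : ∀ l' ∈ (c.1 * ℓ).primeFactors, Zhang2014.IsKolyvaginPrime (W.conductorNorm ℤ) W K p l' ∧
        k ≤ Zhang2014.kolyvaginIndex W p l' := by
      intro l' hl'
      rw [hpf, Finset.mem_union, Finset.mem_singleton] at hl'
      rcases hl' with h | rfl
      · exact hcK l' h
      · exact ⟨h1, h2⟩
    -- the sign at `cℓ`: `ε(−1)^{r+1} = −e'`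
    obtain ⟨-, hsignℓ⟩ := sign_conjAct_kolyvaginClass hK hD3 hD4 hH hp2 hρ τ hτ Dt β ι hcl hk hcKℓ
      (dℓ ℓ h1 h3)
    have hcard : (c.1 * ℓ).primeFactors.card = c.1.primeFactors.card + 1 := by
      rw [hpf, Finset.card_union_of_disjoint (Finset.disjoint_singleton_right.mpr h3),
        Finset.card_singleton]
    rw [hcard, pow_succ, ← mul_assoc, ← he', mul_neg_one] at hsignℓ
    refine mem_signPart_relaxedAt_selmerF0 W τ _ (-e') 𝒯 𝒮 hc0 Qcar v _ hsignℓ ?_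
      (fun q hq _ ↦ h49str ℓ h1 h2 h3 (dℓ ℓ h1 h3) q hq)
      (fun w hw _ _ ↦ h49tr ℓ h1 h2 h3 (dℓ ℓ h1 h3) w hw)
    -- the Kummer part: Gross 6.2 (1) mod GZ31 at level `cℓ`, at every place not over `cℓ`
    intro w hwc hwv _
    refine localization_kolyvaginClass_mem_kummerSelmerStructure_of_GZ31_kolyvagin hK hD3 hD4 hH hp2
      hρ Dt β ι hcop' hGZ hcl hcKℓ (dℓ ℓ h1 h3) w fun l' hl' hP ↦ ?_
    rw [hpf, Finset.mem_union, Finset.mem_singleton] at hl'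
    rcases hl' with h | rfl
    · exact hwc l' h hP
    · obtain ⟨q, rfl, hq⟩ := hP
      exact hwv (congrArg Sum.inr
        (HeightOneSpectrum.eq_of_natCast_mem_of_isPrime_span h1.1 h1.2.2.2.2.1 hq hv))
  -- assemble through the row theorem (h32 = Cor 3.2 PROVED)
  exact tamagawaExponent_le_mInfty_of_rowData McCallum1991.cor32_eigenclasses_infinite_primes_localOrder_holds
    h44 W hcm K hK hD3 hD4 hH p hp2 htower Dt β ι τ hτ k t mInf hk htk hik c.1 c.2.1 hcK hcore e' he d
    hκsel hκsign hκ0 hordκ 𝒯 𝒮 hT hS Qcar hQcar C' hC hdual_q (fun ℓ h1 _ h3 ↦ dℓ ℓ h1 h3)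
    (fun ℓ h1 _ h3 ↦ hdℓ ℓ h1 h3) h49 hdual_ℓ

end Summit.BirchSwinnertonDyer.Rank1Residual.JET

end
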